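import Summits.KontsevichZagierPeriods.Zeta5Search.LaiSweepShard
import Summits.KontsevichZagierPeriods.Zeta5Search.LaiKappa3Cells

/-!
# Order-cell sweep certificates for the `κ₃` point, 6/6: the regimes are correct; `SweepCert → κ₃`

HONEST FRAMING. Systematic-search bookkeeping for the `κ₃` point `(74, 2180, 444; δ74)` of
`LaiKappa3Assembly`; no irrationality claim unless certified — this file checks no shard of the `κ₃`
sweep and proves nothing about `ζ(5)`. 'κ₃ ≤ 73' holds in the tree only once the capstone
`LaiKappa3SweepCert` (all shards checked by `decide +kernel`, seams and summed bounds by `decide`)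
is accepted.

The two regimes of the engine are correct (`RA_ok`, `RB_ok`: cover and slope checks by kernel
evaluation; the crude minorant `⌊y + r x⌋ + ⌊(r+M) x − y⌋ ≥ ⌊(2r+M) x⌋ − 1`, `tsB_link`), so every
shard's regime is (`Shard.regime_ok`); a `SweepCert` therefore yields a `Kappa3CellCert`
(`SweepCert.toCellCert`: `wf`/`adm` from `cellsL_good`, `disj` from the chain via
`cellsDisjoint_of_cellChain`, `lo`/`hi` from the summed integer bounds via
`le_cellRateTrunc_of_LBNat` / `cellRateUB_le_of_UBNat`), and
`kappa3_three_le_oddZetaSpanRank_of_cellCert` applies.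

## Main results

* `Sweep.RA_ok`, `Sweep.RB_ok`, `Sweep.Shard.regime_ok`, `Sweep.SweepCert.toCellCert`.
* `Sweep.kappa3_three_le_oddZetaSpanRank_of_sweepCert (Γ : SweepCert) : 3 ≤ oddZetaSpanRank 36`.

Cost of the whole `κ₃` sweep (measured 2026-08-21): 71,020 cells in 889 shards of 80 cells, ≈ 26 s
of kernel time per shard, ≈ 6.4 kernel-hours in total, zero bytes of cell data.
-/

open Finset Literature.NumberTheory.Transcendental.Zudilin2004
open Literature.NumberTheory.Transcendental.Zudilin2004.PhiCert

namespace Summit.KontsevichZagierPeriods.Zeta5Search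

open SavingCheck

namespace Sweep

/-! ### The two regimes are correct -/

/-- The first two terms of `laiTerms74` are the steep ones. [folklore] -/
theorem laiTerms74_split :
    laiTerms74 = ⟨1, .yax, -2180⟩ :: ⟨1, .axy, 2624⟩ :: laiTerms74.drop 2 := rfl

/-- `evalSum` of a cons. [folklore] -/
theorem evalSum_cons (T : Term) (ts : List Term) (x y : ℚ) :
    evalSum (T :: ts) x y = T.eval x y + evalSum ts x y := by
  simp [evalSum]

/-- **The crude minorant of regime B**: `⌊y + r x⌋ + ⌊(r+M) x − y⌋ ≥ ⌊(2r+M) x⌋ − 1`.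
[cite: Zudilin2004, §8 p. 271] -/
theorem tsB_link (x y : ℚ) : -1 + evalSum tsB x y ≤ evalSum laiTerms74 x y := by
  conv_rhs => rw [laiTerms74_split]
  rw [tsB, evalSum_cons, evalSum_cons, evalSum_cons]
  have h := Int.le_floor_add_floor (y - ((-2180 : ℤ) : ℚ) * x) (((2624 : ℤ) : ℚ) * x - y)
  have e : (y - ((-2180 : ℤ) : ℚ) * x) + (((2624 : ℤ) : ℚ) * x - y) = ((4804 : ℤ) : ℚ) * x := by
    push_cast; ring
  rw [e] at h
  simp only [Term.eval, one_mul]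
  linarith

/-- Regime A is correct (cover and slope checks by kernel evaluation). [folklore] -/
theorem RA_ok : RA.OK where
  cover := by decide +kernel
  small := by decide +kernel
  link := fun x y _ _ => by simp [RA]

/-- Regime B is correct (cover and slope checks by kernel evaluation; the crude minorant).
[folklore] -/
theorem RB_ok : RB.OK where
  cover := by decide +kernel
  small := by decide +kernel
  link := fun x y _ _ => tsB_link x y

/-- The regime of a shard is correct. [folklore] -/
theorem Shard.regime_ok (s : Shard) : s.regime.OK := by
  unfold Shard.regime
  cases s.crude
  · exact RA_ok
  · exact RB_ok

/-! ### From a sweep certificate to `Kappa3CellCert` -/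

/-- The saving table of a sweep certificate: all cells of all shards. [folklore] -/
def SweepCert.T (Γ : SweepCert) : List SavingCell := cellsL (Γ.shards.map (·.s))

/-- The final check, unpacked. [folklore] -/
theorem SweepCert.cert' (Γ : SweepCert) :
    seamOK (Γ.shards.map (·.s)) = true ∧ 0 < Γ.D ∧
    38700 * Γ.D ≤ ((Γ.shards.map (·.s)).map Shard.Lo).sum ∧
    ((Γ.shards.map (·.s)).map Shard.Up).sum ≤ 80000 * Γ.D := by
  have h := Γ.cert
  simp only [certCheck, Bool.and_eq_true, decide_eq_true_eq] at h
  exact ⟨h.1.1.1, h.1.1.2, h.1.2, h.2⟩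

/-- The cells of a sweep certificate are well formed. [folklore] -/
theorem SweepCert.wf (Γ : SweepCert) : ∀ C ∈ Γ.T, C.WF 434 = true :=
  fun C hC => (cellsL_good Shard.regime_ok Γ.shards C hC).1

/-- **A sweep certificate is a cell-table certificate** (`Kappa3CellCert` of `LaiKappa3Cells`).
[cite: Lai2024BallRivoal, §4 Lemma 4.3] -/
noncomputable def SweepCert.toCellCert (Γ : SweepCert) : Kappa3CellCert where
  T := Γ.T
  K := Γ.K
  wf := Γ.wf
  disj := cellsDisjoint_of_cellChain Γ.T (cellsL_cellChain Shard.regime_ok Γ.shards Γ.cert'.1) Γ.wf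
  adm C hC := (cellsL_good Shard.regime_ok Γ.shards C hC).2
  lo := by
    have h := le_cellRateTrunc_of_LBNat Γ.T (by norm_num : 0 < 434) Γ.wf Γ.K Γ.D 38700 Γ.cert'.2.1
      (Γ.cert'.2.2.1.trans (cellsL_lb Shard.regime_ok Γ.shards))
    exact_mod_cast h
  hi := by
    have h := cellRateUB_le_of_UBNat Γ.T (by norm_num : 0 < 434) Γ.wf Γ.D 80000 Γ.cert'.2.1
      ((cellsL_ub Shard.regime_ok Γ.shards).trans Γ.cert'.2.2.2)
    exact_mod_cast h

/-- **Main theorem of the file.** A sweep certificate of the `κ₃` point `(74, 2180, 444; δ74)` — a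
list of shards each checked by `decide +kernel`, with checked seams and summed rate bounds — proves
`3 ≤ dim_ℚ Span{1, ζ(3), ζ(5), …, ζ(73)}`, i.e. 'κ₃ ≤ 73', through `Kappa3CellCert`. No shard of the
`κ₃` sweep is checked in this file. [cite: Lai2024BallRivoal, §4 Lemma 4.3] -/
theorem kappa3_three_le_oddZetaSpanRank_of_sweepCert (Γ : SweepCert) : 3 ≤ oddZetaSpanRank 36 :=
  kappa3_three_le_oddZetaSpanRank_of_cellCert Γ.toCellCert

end Sweep

end Summit.KontsevichZagierPeriods.Zeta5Search
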